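import Literature.Probability.LatticeModels.HardCoreUrsell
import Literature.Probability.LatticeModels.ClusterExpansion

/-!
# NE5 ∕ U3, route P2 — R-IDENT part (A1): the ORDERED (Mayer ∕ Ursell) series of a finite hard-core polymer system,
# its level sums, and the two combinatorial identities that drive the identification with the Kotecký–Preiss logarithm

Cell `pub-balaban`, unit `b2b-balaban-t4-ne5-p2` (T⁴ fan-out NE5 ∕ node U3, PROVER seat P2 «polymer-activity Lipschitz ∕
Kotecký–Preiss route», lineage gen 18; journal CLAIM «R-IDENT», `CLAIMS.log` 2026-08-20).  Summits-side new work under the LEAN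
PLACEMENT RULE (our generic bridge lemmas; NOT a Literature module, NOT a statement about any Bałaban paper).  HONEST FRAMING:
rung (B)+1 of the FINITE-VOLUME T⁴ continuum programme — NOT infinite volume, NOT a mass gap, NOT the Clay problem, NOT a proof
of NE5.  HONEST DEPENDENCY (cell line, verbatim): continuum YM on T⁴ ⇐ BetaPertH ∧ nine spine estimates (0/9 proved); BetaPertH ⇐
(D1) ∧ (D4) ∧ CAP+tail; G-an2-4 gates asym, D1 and NE2/3/4.

WHY (the junction question «R-IDENT» of the two NE5 routes, journal l.6827).  The model of record of row NE5
(`B13StepTermFamily.out`, `B13StepOfRecord`) types [Balaban1988RG2Cluster] (2.13) in the ORDERED-TUPLE form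
`E(X) = Σ_n (1∕n!) Σ_{(Z₁,…,Zₙ): ∪Zᵢ = X} ρᵀ(Z₁,…,Zₙ) Π H(Zᵢ)` with `ρᵀ` the tree's Möbius-defined hard-core Ursell coefficient
`Literature.Probability.LatticeModels.hcUrsell` of the tuple's incompatibility graph, whereas route P2 (`T4ActivityLipschitz.ClusterRep`,
`ClusterRepOfDomains`) types it in the KOTECKÝ–PREISS form `Σ_{K: ∪K = X} Φᵀ(K)` with `Φᵀ = truncatedWeight` the Möbius transform
of the continuous-branch logarithm `polymerLogZ` of `Literature.Probability.LatticeModels.ClusterExpansion`.  The classical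
identification of the two (Mayer's theorem: the logarithm of the hard-core partition function IS the ordered Ursell series where
the latter converges absolutely; then Möbius inversion by supports) is in no tree module (`Dimock2011to13.MayerExpansion` §5 takes
the published Kotecký–Preiss road and says so).  This file is its COMBINATORIAL half, for a finite polymer TYPE `β` (a finite set of
polymers of a bigger type is transported in part (A2) `UrsellMayerLog`):
* §1 `tgraph inc Z` (the incompatibility graph a tuple `Z : ι → β` induces on its index type), `ursT inc Z := hcUrsell (tgraph inc Z)
  univ` (= `B13StepTermFamily.rhoT` for `ι = Fin n`, by `rfl`), `freeT inc Z := edgeFreeInd (tgraph inc Z) univ` (the hard-core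
  Boltzmann factor of the tuple); relabelling invariance and restriction to a sub-index-set;
* §2 the LEVEL SUMS over all `n`-tuples: `U inc w n = Σ_{Z : Fin n → β} ρᵀ(Z) Π w(Z m)`, `E inc w n = Σ_Z freeT(Z) Π w(Z m)`, and the
  compatible-family sums by cardinality `zc inc w n = Σ_{X compatible, #X = n} Π_{γ∈X} w γ`;
* §3 **`E_eq_factorial_mul_zc`**: `E n = n! · zc n` for a REFLEXIVE symmetric hard core (an edge-free tuple is injective and its
  image is a compatible family; each family of size `n` has `n!` orderings) — by induction on `n` with the activity cut at the
  first entry (`wcut`), the marked-element identity `(n+1)·zc (n+1) = Σ_a w a · zc_{w cut at a} n`;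
The sibling `UrsellMayerRooted` (A1, second half) adds the ROOTED BLOCK DECOMPOSITION summed over tuples, the convolution identity
`(n+1)·zc (n+1) = Σ_{p ≤ n} (U (p+1)∕p!)·zc (n−p)` (coefficient form of `Z′ = F′·Z`) and the partition function by levels.
Everything is finite algebra over `ℂ`; no estimate, no Bałaban object.  0 sorry; axioms ⊆ {propext, Classical.choice, Quot.sound}.
References for the mathematics (FORM only; nothing is cited as a hypothesis): S. Friedli, Y. Velenik, *Statistical Mechanics of
Lattice Systems*, CUP 2017, §5.3–§5.4 (Prop. 5.3, (5.10)); D. Ruelle, *Statistical Mechanics*, 1969, §4.4; C. Cammarota, CMP 85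
(1982) 517–528; R. Kotecký, D. Preiss, CMP 103 (1986) 491–498.
-/

noncomputable section

open Finset
open scoped BigOperators

namespace Summit.QuantumFields.BalabanUV.T4Continuum.UrsellMayerSeries

open Literature.Probability.LatticeModels (IsCompatible hcUrsell edgeFreeInd isCompatible_iff isCompatible_insert
  sum_hcUrsell_mul_edgeFreeInd hcUrsell_map edgeFreeInd_map polymerPartitionFunction polymerRayDeriv
  polymerPartitionFunction_smul_eq)

variable {β : Type*} (inc : β → β → Prop) [DecidableRel inc]

/-! ## §1 The Ursell coefficient and the hard-core factor of an ordered tuple -/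

/-- [folklore] The incompatibility graph a tuple `Z : ι → β` induces on its index type: `m ∼ m' ⟺ ζ(Z m, Z m') = 0`. -/
def tgraph {ι : Type*} (Z : ι → β) : ι → ι → Prop := fun m m' => inc (Z m) (Z m')

/-- [folklore] The induced graph is decidable. -/
instance instDecTgraph {ι : Type*} (Z : ι → β) : DecidableRel (tgraph inc Z) :=
  fun m m' => inferInstanceAs (Decidable (inc (Z m) (Z m')))

omit [DecidableRel inc] in
/-- [folklore] Unfolding the induced graph. -/
theorem tgraph_apply {ι : Type*} (Z : ι → β) (m m' : ι) : tgraph inc Z m m' ↔ inc (Z m) (Z m') := Iff.rfl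

omit [DecidableRel inc] in
/-- [folklore] The induced graph is symmetric when the hard core is. -/
theorem tgraph_symm (hsymm : ∀ a b, inc a b → inc b a) {ι : Type*} (Z : ι → β) :
    ∀ m m', tgraph inc Z m m' → tgraph inc Z m' m := fun _ _ h => hsymm _ _ h

variable {ι : Type*} [Fintype ι] [DecidableEq ι]

/-- [folklore] **ρᵀ(Z)** of an ordered tuple: the Möbius-defined hard-core Ursell coefficient (`hcUrsell`) of the induced graph on
the whole index type (for `ι = Fin n` this is `B13StepTermFamily.rhoT inc Z` by `rfl`). -/
def ursT (Z : ι → β) : ℤ := hcUrsell (tgraph inc Z) univ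

/-- [folklore] The hard-core Boltzmann factor `𝟙[the tuple is pairwise compatible]` of an ordered tuple (`edgeFreeInd` of the
induced graph on the whole index type). -/
def freeT (Z : ι → β) : ℤ := edgeFreeInd (tgraph inc Z) univ

/-- [folklore] `freeT = 1` on a tuple whose distinct indices carry compatible polymers. -/
theorem freeT_eq_one_of (Z : ι → β) (h : ∀ m m', m ≠ m' → ¬ inc (Z m) (Z m')) : freeT inc Z = 1 := by
  unfold freeT edgeFreeInd
  rw [if_pos]
  rw [isCompatible_iff]
  exact fun m _ m' _ hmm' => h m m' hmm'

/-- [folklore] `freeT = 0` on a tuple two distinct indices of which carry incompatible polymers. -/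
theorem freeT_eq_zero_of (Z : ι → β) (h : ¬ ∀ m m', m ≠ m' → ¬ inc (Z m) (Z m')) : freeT inc Z = 0 := by
  unfold freeT edgeFreeInd
  rw [if_neg]
  rw [isCompatible_iff]
  exact fun h' => h fun m m' hmm' => h' m (mem_univ m) m' (mem_univ m') hmm'

/-- [folklore] `freeT` only takes the values `0` and `1`. -/
theorem freeT_eq_zero_or_one (Z : ι → β) : freeT inc Z = 0 ∨ freeT inc Z = 1 := by
  by_cases h : ∀ m m', m ≠ m' → ¬ inc (Z m) (Z m')
  · exact Or.inr (freeT_eq_one_of inc Z h)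
  · exact Or.inl (freeT_eq_zero_of inc Z h)

/-- [folklore] RELABELLING INVARIANCE of `ρᵀ`: composing the tuple with a bijection of index types does not change it. -/
theorem ursT_comp_equiv {ι' : Type*} [Fintype ι'] [DecidableEq ι'] (Z : ι → β) (e : ι' ≃ ι) :
    ursT inc (Z ∘ e) = ursT inc Z := by
  have h := hcUrsell_map e.toEmbedding (H := tgraph inc (Z ∘ e)) (H' := tgraph inc Z) (fun a b => Iff.rfl) univ
  rw [Finset.map_univ_equiv] at h
  exact h.symm

/-- [folklore] RELABELLING INVARIANCE of the hard-core factor. -/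
theorem freeT_comp_equiv {ι' : Type*} [Fintype ι'] [DecidableEq ι'] (Z : ι → β) (e : ι' ≃ ι) :
    freeT inc (Z ∘ e) = freeT inc Z := by
  have h := edgeFreeInd_map e.toEmbedding (H := tgraph inc (Z ∘ e)) (H' := tgraph inc Z) (fun a b => Iff.rfl) univ
  rw [Finset.map_univ_equiv] at h
  exact h.symm

/-- [folklore] RESTRICTION: the Ursell coefficient of the induced graph on a sub-index-set `S` is `ρᵀ` of the restricted tuple. -/
theorem hcUrsell_tgraph_eq_ursT (Z : ι → β) (S : Finset ι) :
    hcUrsell (tgraph inc Z) S = ursT inc (fun i : S => Z i) := by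
  have h := hcUrsell_map (Function.Embedding.subtype (· ∈ S)) (H := tgraph inc (fun i : S => Z i))
    (H' := tgraph inc Z) (fun a b => Iff.rfl) univ
  rw [Finset.univ_map_subtype, Finset.filter_univ_mem] at h
  exact h

/-- [folklore] RESTRICTION for the hard-core factor, complement form: `edgeFreeInd` on `univ ∖ S` is `freeT` of the tuple
restricted to the indices outside `S`. -/
theorem edgeFreeInd_tgraph_sdiff_eq_freeT (Z : ι → β) (S : Finset ι) :
    edgeFreeInd (tgraph inc Z) (univ \ S) = freeT inc (fun i : {m // m ∉ S} => Z i) := by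
  have h := edgeFreeInd_map (Function.Embedding.subtype (· ∉ S)) (H := tgraph inc (fun i : {m // m ∉ S} => Z i))
    (H' := tgraph inc Z) (fun a b => Iff.rfl) univ
  have hS : (univ.filter fun m : ι => m ∉ S) = univ \ S := by
    ext m; simp
  rw [Finset.univ_map_subtype, hS] at h
  exact h

/-! ## §2 Level sums of the ordered series and the compatible-family sums by cardinality -/

section Levels

variable [Fintype β] [DecidableEq β] (w : β → ℂ)

/-- [folklore] **LEVEL `n` OF THE ORDERED URSELL SERIES** (before division by `n!`): `Σ_{Z : Fin n → β} ρᵀ(Z)·Π_m w(Z m)`. -/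
def U (n : ℕ) : ℂ := ∑ Z : Fin n → β, (ursT inc Z : ℂ) * ∏ m, w (Z m)

/-- [folklore] LEVEL `n` OF THE ORDERED PARTITION FUNCTION: `Σ_{Z : Fin n → β} 𝟙[Z pairwise compatible]·Π_m w(Z m)`. -/
def E (n : ℕ) : ℂ := ∑ Z : Fin n → β, (freeT inc Z : ℂ) * ∏ m, w (Z m)

/-- [folklore] The compatible-family sum at cardinality `n`: `Σ_{X ⊆ β compatible, #X = n} Π_{γ∈X} w γ` (the degree-`n` coefficient of
`t ↦ Z(t•w)`). -/
def zc (n : ℕ) : ℂ := ∑ X ∈ (univ : Finset β).powerset with (IsCompatible inc X ∧ X.card = n), ∏ γ ∈ X, w γ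

/-- [folklore] The activity CUT at a polymer `a`: zero on the polymers incompatible with `a` (including `a` itself for a reflexive
hard core). -/
def wcut (a : β) : β → ℂ := fun γ => if inc a γ then 0 else w γ

omit [Fintype β] [DecidableEq β] in
/-- [folklore] The cut activity at a compatible polymer is the activity. -/
theorem wcut_of_not {a γ : β} (h : ¬ inc a γ) : wcut inc w a γ = w γ := if_neg h

omit [Fintype β] [DecidableEq β] in
/-- [folklore] The cut activity at an incompatible polymer vanishes. -/
theorem wcut_of {a γ : β} (h : inc a γ) : wcut inc w a γ = 0 := if_pos h

omit [DecidableEq β] in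
/-- [folklore] At level `0` the ordered partition function is `1` (one empty tuple, compatible, empty product). -/
theorem E_zero : E inc w 0 = 1 := by
  unfold E
  rw [Fintype.sum_unique, freeT_eq_one_of inc _ (fun m => Fin.elim0 m)]
  simp

/-- [folklore] At cardinality `0` the compatible-family sum is `1` (the empty family). -/
theorem zc_zero : zc inc w 0 = 1 := by
  unfold zc
  rw [Finset.sum_eq_single_of_mem (∅ : Finset β)]
  · simp
  · simp [IsCompatible]
  · intro X hX hne
    have h := (Finset.mem_filter.1 hX).2.2
    exact absurd (Finset.card_eq_zero.1 h) hne

/-- [folklore] Beyond the number of polymers the compatible-family sums vanish. -/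
theorem zc_eq_zero_of_lt {n : ℕ} (hn : Fintype.card β < n) : zc inc w n = 0 := by
  unfold zc
  refine Finset.sum_eq_zero fun X hX => ?_
  have h := (Finset.mem_filter.1 hX).2.2
  have hle : X.card ≤ Fintype.card β := Finset.card_le_univ X
  omega

end Levels

/-! ## §3 `E n = n! · zc n`: edge-free tuples are the orderings of compatible families -/

section Orderings

variable [Fintype β] [DecidableEq β]

omit [Fintype β] [DecidableEq β] in
/-- [folklore] Prepending a first entry `a` compatible with every other entry does not change the hard-core factor
(reflexive symmetric hard core). -/
theorem freeT_cons_of_compat (hsymm : ∀ a b, inc a b → inc b a) {n : ℕ} (a : β) (Z : Fin n → β)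
    (ha : ∀ m, ¬ inc a (Z m)) : freeT inc (Fin.cons a Z : Fin (n + 1) → β) = freeT inc Z := by
  by_cases hZ : ∀ m m', m ≠ m' → ¬ inc (Z m) (Z m')
  · rw [freeT_eq_one_of inc Z hZ, freeT_eq_one_of]
    intro m m'
    refine Fin.cases ?_ (fun i => ?_) m <;> refine Fin.cases ?_ (fun j => ?_) m' <;> intro hne
    · exact absurd rfl hne
    · simpa only [Fin.cons_zero, Fin.cons_succ] using ha j
    · simpa only [Fin.cons_zero, Fin.cons_succ] using fun h' => ha i (hsymm _ _ h')
    · simpa only [Fin.cons_succ] using hZ i j (fun heq => hne (by rw [heq]))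
  · rw [freeT_eq_zero_of inc Z hZ, freeT_eq_zero_of]
    intro h
    exact hZ fun m m' hmm' => by
      simpa only [Fin.cons_succ] using h m.succ m'.succ (fun heq => hmm' (Fin.succ_injective _ heq))

omit [Fintype β] [DecidableEq β] in
/-- [folklore] Prepending a first entry incompatible with some other entry kills the hard-core factor. -/
theorem freeT_cons_of_not (a : β) {n : ℕ} (Z : Fin n → β) (ha : ¬ ∀ m, ¬ inc a (Z m)) :
    freeT inc (Fin.cons a Z : Fin (n + 1) → β) = 0 := by
  refine freeT_eq_zero_of inc _ fun h => ?_
  push Not at ha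
  obtain ⟨m, hm⟩ := ha
  exact h 0 m.succ (Fin.succ_ne_zero m).symm (by simpa only [Fin.cons_zero, Fin.cons_succ] using hm)

omit [DecidableEq β] in
/-- [folklore] The level sum over `(n+1)`-tuples as a sum over the first entry and the remaining `n`-tuple. -/
theorem sum_tuple_succ {M : Type*} [AddCommMonoid M] {n : ℕ} (F : (Fin (n + 1) → β) → M) :
    ∑ Z : Fin (n + 1) → β, F Z = ∑ a : β, ∑ Z : Fin n → β, F (Fin.cons a Z) := by
  rw [← Fintype.sum_prod_type']
  exact (Fintype.sum_equiv (Fin.consEquiv fun _ => β) (fun p => F (Fin.cons p.1 p.2)) F fun _ => rfl).symm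

omit [Fintype β] [DecidableEq β] in
/-- [folklore] Cutting the activity at `a` absorbs the constraint «every entry compatible with `a`»:
`freeT(a∷Z)·Π w(Z m) = freeT(Z)·Π w_{cut a}(Z m)`. -/
theorem freeT_cons_mul_prod (hsymm : ∀ a b, inc a b → inc b a) (w : β → ℂ) {n : ℕ} (a : β) (Z : Fin n → β) :
    (freeT inc (Fin.cons a Z : Fin (n + 1) → β) : ℂ) * ∏ m, w (Z m) =
      (freeT inc Z : ℂ) * ∏ m, wcut inc w a (Z m) := by
  by_cases h : ∀ m, ¬ inc a (Z m)
  · rw [freeT_cons_of_compat inc hsymm a Z h]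
    congr 1
    exact Finset.prod_congr rfl fun m _ => (wcut_of_not inc w (h m)).symm
  · rw [freeT_cons_of_not inc a Z h, Int.cast_zero, zero_mul]
    push Not at h
    obtain ⟨m, hm⟩ := h
    rw [Finset.prod_eq_zero (Finset.mem_univ m) (wcut_of inc w hm), mul_zero]

omit [DecidableEq β] in
/-- [folklore] THE FIRST-ENTRY RECURSION of the ordered partition function: `E_w (n+1) = Σ_a w a · E_{w cut at a} n`. -/
theorem E_succ_eq_sum_wcut (hsymm : ∀ a b, inc a b → inc b a) (w : β → ℂ) (n : ℕ) :
    E inc w (n + 1) = ∑ a : β, w a * E inc (wcut inc w a) n := by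
  unfold E
  rw [sum_tuple_succ]
  refine Finset.sum_congr rfl fun a _ => ?_
  rw [Finset.mul_sum]
  refine Finset.sum_congr rfl fun Z _ => ?_
  rw [Fin.prod_univ_succ]
  simp only [Fin.cons_zero, Fin.cons_succ]
  rw [mul_left_comm, freeT_cons_mul_prod inc hsymm w a Z]

/-- [folklore] THE MARKED-ELEMENT IDENTITY for compatible families: `(n+1)·zc_w (n+1) = Σ_a w a · zc_{w cut at a} n` (mark one
member `a` of a compatible family of size `n+1`; the rest is a compatible family of size `n` compatible with `a`; a reflexive hard
core excludes `a` from the rest). -/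
theorem succ_mul_zc_succ_eq_sum_wcut (hrefl : ∀ a, inc a a) (hsymm : ∀ a b, inc a b → inc b a) (w : β → ℂ) (n : ℕ) :
    ((n : ℂ) + 1) * zc inc w (n + 1) = ∑ a : β, w a * zc inc (wcut inc w a) n := by
  classical
  -- the left side as a double sum over (family, marked member)
  set S : ℕ → Finset (Finset β) := fun k => (univ : Finset β).powerset.filter fun X => IsCompatible inc X ∧ X.card = k
    with hS
  have hmemS : ∀ {k X}, X ∈ S k ↔ IsCompatible inc X ∧ X.card = k := by
    intro k X
    simp only [hS, Finset.mem_filter, Finset.mem_powerset, Finset.subset_univ, true_and]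
  have hL : ((n : ℂ) + 1) * zc inc w (n + 1) = ∑ X ∈ S (n + 1), ∑ a ∈ X, w a * ∏ γ ∈ X.erase a, w γ := by
    unfold zc
    rw [Finset.mul_sum]
    refine Finset.sum_congr rfl fun X hX => ?_
    have hcard : X.card = n + 1 := (hmemS.1 hX).2
    rw [Finset.sum_congr rfl fun a ha => Finset.mul_prod_erase X w ha, Finset.sum_const, hcard, nsmul_eq_mul]
    push_cast
    ring
  -- the right side: the cut activity restricts the inner families to those compatible with `a`
  have hR : ∑ a : β, w a * zc inc (wcut inc w a) n =
      ∑ a : β, ∑ Y ∈ (S n).filter (fun Y => ∀ γ ∈ Y, ¬ inc a γ), w a * ∏ γ ∈ Y, w γ := by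
    refine Finset.sum_congr rfl fun a _ => ?_
    symm
    rw [Finset.sum_filter]
    unfold zc
    rw [Finset.mul_sum]
    refine Finset.sum_congr rfl fun Y _ => ?_
    symm
    by_cases h : ∀ γ ∈ Y, ¬ inc a γ
    · rw [if_pos h]
      congr 1
      exact Finset.prod_congr rfl fun γ hγ => wcut_of_not inc w (h γ hγ)
    · rw [if_neg h]
      push Not at h
      obtain ⟨γ, hγ, hinc⟩ := h
      rw [Finset.prod_eq_zero hγ (wcut_of inc w hinc), mul_zero]
  rw [hL, hR, Finset.sum_sigma', Finset.sum_sigma']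
  refine Finset.sum_nbij' (fun x => ⟨x.2, x.1.erase x.2⟩) (fun y => ⟨insert y.1 y.2, y.1⟩) ?_ ?_ ?_ ?_ ?_
  · rintro ⟨X, a⟩ hx
    obtain ⟨hX, ha⟩ := Finset.mem_sigma.1 hx
    obtain ⟨hcomp, hcard⟩ := hmemS.1 hX
    refine Finset.mem_sigma.2 ⟨Finset.mem_univ _, Finset.mem_filter.2 ⟨hmemS.2 ⟨hcomp.mono (X.erase_subset a), ?_⟩, ?_⟩⟩
    · rw [Finset.card_erase_of_mem ha, hcard]; rfl
    · intro γ hγ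
      obtain ⟨hne, hγX⟩ := Finset.mem_erase.1 hγ
      exact (isCompatible_iff.1 hcomp) a ha γ hγX (fun h => hne h.symm)
  · rintro ⟨a, Y⟩ hy
    obtain ⟨-, hY⟩ := Finset.mem_sigma.1 hy
    obtain ⟨hYS, hYa⟩ := Finset.mem_filter.1 hY
    obtain ⟨hcomp, hcard⟩ := hmemS.1 hYS
    have haY : a ∉ Y := fun h => hYa a h (hrefl a)
    refine Finset.mem_sigma.2 ⟨hmemS.2 ⟨(isCompatible_insert hsymm haY).2 ⟨hcomp, hYa⟩, ?_⟩, Finset.mem_insert_self a Y⟩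
    rw [Finset.card_insert_of_notMem haY, hcard]
  · rintro ⟨X, a⟩ hx
    obtain ⟨-, ha⟩ := Finset.mem_sigma.1 hx
    simp only [Finset.insert_erase ha]
  · rintro ⟨a, Y⟩ hy
    obtain ⟨-, hY⟩ := Finset.mem_sigma.1 hy
    obtain ⟨hYS, hYa⟩ := Finset.mem_filter.1 hY
    have haY : a ∉ Y := fun h => hYa a h (hrefl a)
    simp only [Finset.erase_insert haY]
  · rintro ⟨X, a⟩ -
    rfl

/-- [folklore] **THE ORDERINGS IDENTITY**: for a reflexive symmetric hard core, the level-`n` ordered partition function is `n!`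
times the compatible-family sum at cardinality `n` — `Σ_{Z : Fin n → β} 𝟙[Z compatible]·Π w(Z m) = n!·Σ_{#X = n, X compatible} Π_X w`. -/
theorem E_eq_factorial_mul_zc (hrefl : ∀ a, inc a a) (hsymm : ∀ a b, inc a b → inc b a) :
    ∀ (n : ℕ) (w : β → ℂ), E inc w n = (n.factorial : ℂ) * zc inc w n := by
  intro n
  induction n with
  | zero => intro w; rw [E_zero, zc_zero]; simp
  | succ n ih =>
    intro w
    rw [E_succ_eq_sum_wcut inc hsymm w n, Finset.sum_congr rfl fun a _ => by rw [ih (wcut inc w a)], Nat.factorial_succ]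
    push_cast
    rw [mul_assoc, mul_left_comm, succ_mul_zc_succ_eq_sum_wcut inc hrefl hsymm w n, Finset.mul_sum]
    refine Finset.sum_congr rfl fun a _ => ?_
    ring

end Orderings

end Summit.QuantumFields.BalabanUV.T4Continuum.UrsellMayerSeries

end
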